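import Summits.QuantumFields.YangMills.Theorems.FluctuationComparisonRegPrIntLS1aOneStepContinuousDensity
import Summits.QuantumFields.YangMills.Theorems.FluctuationComparisonRegPrIntLS1aChartSideNullTraces
import Summits.QuantumFields.YangMills.Theorems.FluctuationComparisonRegPrIntLS1aCutStepContinuousDensity
import Summits.QuantumFields.YangMills.Theorems.BackwardLiouvilleRigidityAdmFRFrameInhabited
import HarnessLib

/-!
# `FluctuationComparisonRegPrIntLS1aAnchorStepContinuousDensity` — S1aᴴ (c) AT THE ANCHOR HEIGHTS: THE UNCUT RENORMALIZATION STEP OF THE T³ RUNS TRANSFORMS AN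
# EVERYWHERE-CONTINUOUS BOUNDED DENSITY INTO AN EVERYWHERE-CONTINUOUS BOUNDED DENSITY, SO EVERY LAW `ν K j` (`j ≤ K`) OF A RUN HAS A CONTINUOUS DENSITY
# (`Node00.regSet dU_j ρ_j = univ` — the one-version door's `hreg` at the anchor heights `Ts ≤ j ≤ K`)

Cell `ym3-torus` (HUMAN RULING D-0037: rung R3 = continuum SU(2) Yang–Mills on T³ — NOT d = 4, NOT infinite volume, NOT a mass gap, NOT Clay), WIDTH COPY «width 17»
of ym3-torus-p1, seat `ym3-torus-px17` gen 21; `--kind proof --supports stmt-QuantumFields-20520 --as helper` (count-neutral; crux `FluctuationComparisonRegPrIntL`, LINE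
`Lines/runpair_organ.lean`, stub S1aᴴ `stub_runClassMembershipH : RunClassMembershipH`, conjunct (c) `ContinuousOn (ρ j) {PlaqSmall (θBal … j)}` at the ANCHOR heights
`Ts ≤ j ≤ K` where `μ j = ν K j = (descend F ℰp j)_* ν K (j+1)` is the UNCUT (0.4) step; the seat's 12:58Z INTENT, FILE (F7)).  THEOREMS ONLY (no `def`, no `sorry`, no
`instance`, no `notation`, default heartbeats).  [UV3] = [Balaban1985UV3] (CMP 102), [I] = [Balaban1987RG1] (CMP 109).

WHY.  UV3-NODE §67.3 ∕ §77 ∕ §79: S1aᴴ's conjunct (iv) needs, at every height of a run, a density of `μ j` continuous on the small-field window; the one-version door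
(✓`…S1aTowerLawInvariance.exists_invariantVersion`) reduces this to `window ⊆ Node00.regSet dU_j ρ₀_j` for SOME density family `ρ₀`; px17 g20 closed the CUT heights
(✓`…S1aCutStepContinuousDensity`, pub-ymgap's N09 engine on the `α`-loop-guard of the cut).  At the ANCHOR heights the step is UNCUT — the (0.4) averaging with its FULL guard
`δ` and identity fallback, where N09's `α ≤ 1∕24` window does not apply — and the input at height `K` is the Gibbs law `e^{−βA}∕Z · dU` (continuous, positive, bounded
density).  THIS FILE closes them: the local-face road on the full guard ((F1)–(F6) of this seat + px20 g22's (F4-b)(F4-c)) gives «one uncut step maps a bounded continuous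
density to a law with a density continuous on ALL coarse fields» (✓`…S1aOneStepContinuousDensity`), the T³ junction `descend F ℰp j = fieldShift _ ∘ avgFun ℰp` (`rfl`,
as in px17 g20's §3), and a descending induction from `K`.

WHAT IS PROVED (0 def, 0 sorry; nothing of Bałaban's asserted).
§1 ★★★ `exists_continuous_density_map_descend` — for every `T3Family F` and height `j` (NO numerics, NO smallness): `ρ′` measurable, continuous, `≥ 0`, bounded on the fine
   fields `GaugeField (F.P (j+1)) 0 SU(2)` ⟹ `∃ g`, continuous, `≥ 0`, bounded, `(dU′·ρ′).map (descend F ℰp j) = dU_j · g` (the (F4-c) null traces of px20 g22's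
   ✓`…S1aChartSideNullTraces` plugged into ✓`exists_continuous_density_map_avgFun_of_continuous` with `η` the additive Haar measure of a basis of `𝔰𝔲(2)` and its Borel σ-algebra;
   transport through `fieldShift` by px17 g20's ✓`map_withDensity_fieldShift`); ★ `exists_continuous_density_anchorStep` — the same in S1aᴴ's letters
   (`μ′ = dU′.withDensity (ofReal ∘ ρ′)` ⟹ `μ′.map (descend F ℰp j) = dU_j.withDensity (ofReal ∘ g)`, `g` continuous, measurable, `≥ 0`, bounded, `Node00.regSet dU_j g = univ`).
§2 ★ `exists_continuous_density_gibbs` — the height-`K` law: `gibbsMeasure (F.P K) β = dU_K.withDensity (ofReal ∘ (boltzmann∕Z))`, continuous, positive, bounded (`β ≥ 0`).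
§3 ★★★ `exists_continuous_density_run` — for every run `ν` (`ν K K` Gibbs at `β_K = (γ·ε_K)⁻¹ ≥ 0`, `ν K j = (descend F ℰp j)_* ν K (j+1)` for `j < K`) and EVERY `j ≤ K`:
   `∃ g`, continuous, measurable, `≥ 0`, bounded, `ν K j = dU_j.withDensity (ofReal ∘ g)`, `Node00.regSet dU_j g = univ`; ★★★ `exists_continuous_density_anchor` — in S1aᴴ's
   letters: under `hanch : ∀ j, Ts ≤ j → μ j = ν K j`, every anchor height `Ts ≤ j ≤ K` carries such a `g` for `μ j` (so conjunct (iv) `ContinuousOn (ρ j) {PlaqSmall θ_j}` holds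
   there for THIS version with room to spare, and the one-version door's `hreg` holds for EVERY open window at the anchor heights).
§4 ★★★ `exists_continuous_density_tower` — THE (c)-DOOR FOR THE WHOLE TOWER: `0 < γ ≤ 1`, `0 < b₀`, any `p₀`; `∃ j₀(F, γ, b₀, p₀)` such that for every run `ν`, every `Ts ≤ K`
   and every tower `μ` anchored at `Ts ≤ j` and cut below `Ts` by the line's `sfCut (θBal_{j+1})` (written out as its product of clipped ramps — px17 g20's letters), EVERY
   height `j₀ ≤ j ≤ K` carries a density of `μ j` continuous everywhere, measurable, `≥ 0`, `Node00.regSet = univ` (§3 at the anchor heights, px17 g20's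
   ✓`exists_continuous_density_cutStep_sfCut` + ✓`exists_cutStep_numerics` at the cut heights, descending induction from `Ts`).

HONEST FRAMING.  Conjunct (c)∕(iv) of S1aᴴ is settled at EVERY height `j₀ ≤ j ≤ K` FOR THE CONTINUOUS VERSIONS exhibited here (cut heights through px17 g20's file); S1aᴴ
itself asks ONE `ρ` carrying (p) positivity, (w) density, (m) `MemOfRun`, (c), (β) `AnalyticPairWindowAt` SIMULTANEOUSLY — (m), (β) and the choice of the common version are NOT
addressed here (the one-version door ✓`exists_invariantVersion` + this file's `regSet = univ` is the intended assembly, LEAD's∕owner's call); the five registered stubs of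
`Lines/runpair_organ.lean`, crux 20520 ∕ 19936 ∕ 19200 and `YM3TorusSU2` are NOT proved; nothing of Bałaban's renormalization-group analysis is asserted or proved (this is
measure theory of the typed (0.4) averaging on compact groups); rung R3 = SU(2) YM₃ on T³ ([UV3] Theorem 1's ultraviolet stability) — NOT d = 4, NOT infinite volume, NOT a
mass gap, NOT Clay; the Yang–Mills mass gap is NOT proved by any of this.
References: [Balaban1985UV3] (4)–(6) p. 257, p. 263 (c); [Balaban1987RG1] (0.4) p. 253, (0.13) p. 254; [Balaban1985Averaging] (10) p. 19.
-/

set_option autoImplicit false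

noncomputable section

open MeasureTheory Set Function Filter Topology
open scoped ENNReal Matrix.Norms.L2Operator
open Literature.MathematicalPhysics.QuantumFieldTheory.Balaban1983to89
open Literature.MathematicalPhysics.QuantumFieldTheory.Balaban1983to89.T3ContinuumYM3Torus
open Literature.MathematicalPhysics.QuantumFieldTheory.Balaban1983to89.T3NestedUnitLaws (descend sitesPerDir_descend)
open Literature.MathematicalPhysics.QuantumFieldTheory.Balaban1983to89.T3UnitLawDensityEML (ℰp)
open Literature.MathematicalPhysics.QuantumFieldTheory.Balaban1983to89.T3LevelShift (fieldShift measurePreserving_fieldShift measurable_fieldShift)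
open Literature.MathematicalPhysics.QuantumFieldTheory.Balaban1983to89.BlockAveraging (avgFun measurable_avgFun)
open Literature.MathematicalPhysics.QuantumFieldTheory.Balaban1983to89.ExpMeanLog (expMeanLogSU deltaSU deltaSU_pos measurable_expMeanLogSU_E)
open Literature.MathematicalPhysics.QuantumFieldTheory.Balaban1983to89.Missing (boltzmann partitionFn boltzmann_pos boltzmann_le_one partitionFn_pos')
open Literature.MathematicalPhysics.QuantumFieldTheory.Balaban1983to89.B16Thm1BaseAtRecord11 (continuous_wilsonAction4_SU)
open Summit.QuantumFields.YangMills.Theorems.FluctuationComparisonRegPrIntLS1aOneStepContinuousDensity (exists_continuous_density_map_avgFun_of_continuous)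
open Summit.QuantumFields.YangMills.Theorems.FluctuationComparisonRegPrIntLS1aChartSideNullTraces (pi_setOf_chart_mem_boundarySlice_eq_zero
  pi_setOf_chart_mem_guardSphere_eq_zero)
open Summit.QuantumFields.YangMills.Theorems.FluctuationComparisonRegPrIntLS1aCutStepContinuousDensity (map_withDensity_fieldShift exists_cutStep_numerics
  exists_continuous_density_cutStep_sfCut)
open Literature.MathematicalPhysics.QuantumFieldTheory.Balaban1983to89.T3UnitScaleTilt (θBal)
open Literature.MathematicalPhysics.QuantumFieldTheory.Balaban1983to89.T3MinimiserStabilityReduction (θBal_pos)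
open Summit.QuantumFields.YangMills.Theorems.AdmFRFrameInhabited (gibbsMeasure_eq_withDensity boltzmann_div_partitionFn_pos)

namespace Summit.QuantumFields.YangMills.Theorems.FluctuationComparisonRegPrIntLS1aAnchorStepContinuousDensity

/-! ## §1 The T³ junction: the uncut step `descend F ℰp j` preserves «bounded continuous density» -/

section Step

variable (F : T3Family) (j : ℕ)

/-- ★★★ **THE UNCUT (0.4) STEP OF THE T³ RUNS TRANSFORMS AN EVERYWHERE-CONTINUOUS BOUNDED DENSITY INTO AN EVERYWHERE-CONTINUOUS BOUNDED ONE** — no numerics, no smallness: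
`(dU′·ρ′).map (descend F ℰp j) = dU_j·g` with `g ≥ 0` continuous and bounded, for every measurable continuous bounded `ρ′ ≥ 0` (✓`exists_continuous_density_map_avgFun_of_continuous`
at `P := F.P (j+1)`, level `0 → 1`, the (F4-c) traces of px20 g22's ✓`…S1aChartSideNullTraces`, `η` = the additive Haar measure of a basis of `𝔰𝔲(2)`, transport through
`fieldShift`). [cite: Balaban1985UV3, (4)-(6) p.257 and p.263 (c); Balaban1987RG1, (0.4) p.253, (0.13) p.254] -/
theorem exists_continuous_density_map_descend
    (ρ' : GaugeField (F.P (j + 1)) 0 ↥(Matrix.specialUnitaryGroup (Fin 2) ℂ) → ℝ) (hρm : Measurable ρ') (hρc : Continuous ρ') (hρ0 : ∀ U, 0 ≤ ρ' U)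
    (hρC : ∃ C₀ : ℝ, ∀ U, ρ' U ≤ C₀) :
    ∃ g : GaugeField (F.P j) 0 ↥(Matrix.specialUnitaryGroup (Fin 2) ℂ) → ℝ, Continuous g ∧ (∀ V, 0 ≤ g V) ∧ (∃ C : ℝ, ∀ V, g V ≤ C) ∧
      ((fieldMeasure (F.P (j + 1)) 0 ↥(Matrix.specialUnitaryGroup (Fin 2) ℂ)).withDensity (fun U => ENNReal.ofReal (ρ' U))).map (descend F ℰp j) =
        (fieldMeasure (F.P j) 0 ↥(Matrix.specialUnitaryGroup (Fin 2) ℂ)).withDensity (fun V => ENNReal.ofReal (g V)) := by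
  classical
  haveI : BorelSpace (GaugeField (F.P (j + 1)) 0 ↥(Matrix.specialUnitaryGroup (Fin 2) ℂ)) := T3OrbitAverage.instBorelSpaceGaugeField
  haveI : BorelSpace (GaugeField (F.P (j + 1)) (0 + 1) ↥(Matrix.specialUnitaryGroup (Fin 2) ℂ)) := T3OrbitAverage.instBorelSpaceGaugeField
  haveI : BorelSpace (GaugeField (F.P j) 0 ↥(Matrix.specialUnitaryGroup (Fin 2) ℂ)) := T3OrbitAverage.instBorelSpaceGaugeField
  -- an additive Haar measure on `𝔰𝔲(2)` with its Borel σ-algebra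
  letI : MeasurableSpace (specialUnitaryLogChart (Fin 2)).lie := borel _
  haveI : BorelSpace (specialUnitaryLogChart (Fin 2)).lie := ⟨rfl⟩
  set η : Measure (specialUnitaryLogChart (Fin 2)).lie := (Module.finBasis ℝ (specialUnitaryLogChart (Fin 2)).lie).addHaar with hη
  have hj : 0 + 1 ≤ (F.P (j + 1)).m + (F.P (j + 1)).K := by show 0 + 1 ≤ F.m + (j + 1); omega
  -- the engine (F6) with the (F4-c) null traces
  obtain ⟨g₁, hg₁c, hg₁0, hset⟩ := exists_continuous_density_map_avgFun_of_continuous (P := F.P (j + 1)) (j := 0) η hj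
    (fun E hE U₀ c v => pi_setOf_chart_mem_boundarySlice_eq_zero η hj U₀ c (deltaSU_pos (n := Fin 2)).ne' E hE v)
    (fun U₀ c v => pi_setOf_chart_mem_guardSphere_eq_zero η hj U₀ c (deltaSU_pos (n := Fin 2)).ne' v) ρ' hρm hρ0 hρC hρc
  -- the measure identity at level `1` of `F.P (j+1)`
  have hAm : Measurable (avgFun (expMeanLogSU (n := Fin 2)) :
      GaugeField (F.P (j + 1)) 0 ↥(Matrix.specialUnitaryGroup (Fin 2) ℂ) → GaugeField (F.P (j + 1)) (0 + 1) ↥(Matrix.specialUnitaryGroup (Fin 2) ℂ)) :=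
    measurable_avgFun _ measurable_expMeanLogSU_E
  have hmap : ((fieldMeasure (F.P (j + 1)) 0 ↥(Matrix.specialUnitaryGroup (Fin 2) ℂ)).withDensity
      (fun U => ENNReal.ofReal (ρ' U))).map (avgFun (expMeanLogSU (n := Fin 2))) =
      (fieldMeasure (F.P (j + 1)) (0 + 1) ↥(Matrix.specialUnitaryGroup (Fin 2) ℂ)).withDensity (fun V => ENNReal.ofReal (g₁ V)) := by
    ext S' hS'
    rw [Measure.map_apply hAm hS', withDensity_apply _ hS']
    exact hset S' hS'
  -- a bound for the continuous `g₁` on the compact configuration space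
  haveI : CompactSpace (GaugeField (F.P (j + 1)) (0 + 1) ↥(Matrix.specialUnitaryGroup (Fin 2) ℂ)) :=
    inferInstanceAs (CompactSpace (PBond (F.P (j + 1)) (0 + 1) → ↥(Matrix.specialUnitaryGroup (Fin 2) ℂ)))
  obtain ⟨C, hC⟩ : ∃ C : ℝ, ∀ V, g₁ V ≤ C := by
    obtain ⟨C, hC⟩ := isCompact_univ.exists_bound_of_continuousOn hg₁c.continuousOn
    exact ⟨C, fun V => (le_abs_self _).trans ((Real.norm_eq_abs _).symm.le.trans (hC V (mem_univ V)))⟩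
  -- transport through the level identification
  have hg₁m : Measurable fun V => ENNReal.ofReal (g₁ V) := ENNReal.measurable_ofReal.comp hg₁c.measurable
  refine ⟨g₁ ∘ fieldShift (sitesPerDir_descend F j 0).symm, hg₁c.comp (continuous_pi fun b => continuous_apply _), fun V => hg₁0 _, ⟨C, fun V => hC _⟩, ?_⟩
  have hdesc : (descend F ℰp j : GaugeField (F.P (j + 1)) 0 ↥(Matrix.specialUnitaryGroup (Fin 2) ℂ) → _) =
      fieldShift (sitesPerDir_descend F j 0) ∘ avgFun (expMeanLogSU (n := Fin 2)) := rfl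
  rw [hdesc]
  calc Measure.map (fieldShift (sitesPerDir_descend F j 0) ∘ avgFun (expMeanLogSU (n := Fin 2)))
        ((fieldMeasure (F.P (j + 1)) 0 ↥(Matrix.specialUnitaryGroup (Fin 2) ℂ)).withDensity (fun U => ENNReal.ofReal (ρ' U)))
      = Measure.map (fieldShift (sitesPerDir_descend F j 0)) (Measure.map (avgFun (expMeanLogSU (n := Fin 2)))
        ((fieldMeasure (F.P (j + 1)) 0 ↥(Matrix.specialUnitaryGroup (Fin 2) ℂ)).withDensity (fun U => ENNReal.ofReal (ρ' U)))) :=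
        (Measure.map_map (measurable_fieldShift _) hAm).symm
    _ = Measure.map (fieldShift (sitesPerDir_descend F j 0))
        ((fieldMeasure (F.P (j + 1)) (0 + 1) ↥(Matrix.specialUnitaryGroup (Fin 2) ℂ)).withDensity (fun V => ENNReal.ofReal (g₁ V))) :=
        congrArg (Measure.map (fieldShift (sitesPerDir_descend F j 0))) hmap
    _ = (fieldMeasure (F.P j) 0 ↥(Matrix.specialUnitaryGroup (Fin 2) ℂ)).withDensity ((fun V => ENNReal.ofReal (g₁ V)) ∘ fieldShift (sitesPerDir_descend F j 0).symm) :=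
        map_withDensity_fieldShift _ _ hg₁m
    _ = _ := rfl

/-- ★ **THE SAME IN S1aᴴ'S LETTERS**: `μ′ = dU′.withDensity (ofReal ∘ ρ′)` with `ρ′` measurable, continuous, `≥ 0`, bounded ⟹ the UNCUT step law `μ′.map (descend F ℰp j)`
has a density `g` w.r.t. `dU_j` continuous, measurable, `≥ 0`, bounded, with `Node00.regSet dU_j g = univ`. [cite: Balaban1985UV3, (4)-(6) p.257 and p.263 (c); Balaban1987RG1, (0.13) p.254] -/
theorem exists_continuous_density_anchorStep
    {ρ' : GaugeField (F.P (j + 1)) 0 ↥(Matrix.specialUnitaryGroup (Fin 2) ℂ) → ℝ} (hρm : Measurable ρ') (hρc : Continuous ρ') (hρ0 : ∀ U, 0 ≤ ρ' U)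
    (hρC : ∃ C₀ : ℝ, ∀ U, ρ' U ≤ C₀)
    {μ' : Measure (GaugeField (F.P (j + 1)) 0 ↥(Matrix.specialUnitaryGroup (Fin 2) ℂ))}
    (hμ' : μ' = (fieldMeasure _ _ _).withDensity (fun U => ENNReal.ofReal (ρ' U))) :
    ∃ g : GaugeField (F.P j) 0 ↥(Matrix.specialUnitaryGroup (Fin 2) ℂ) → ℝ, Continuous g ∧ Measurable g ∧ (∀ V, 0 ≤ g V) ∧ (∃ C : ℝ, ∀ V, g V ≤ C) ∧
      Measure.map (descend F ℰp j) μ' = (fieldMeasure _ _ _).withDensity (fun V => ENNReal.ofReal (g V)) ∧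
      Node00.regSet (fieldMeasure (F.P j) 0 ↥(Matrix.specialUnitaryGroup (Fin 2) ℂ)) g = univ := by
  haveI : BorelSpace (GaugeField (F.P j) 0 ↥(Matrix.specialUnitaryGroup (Fin 2) ℂ)) := T3OrbitAverage.instBorelSpaceGaugeField
  obtain ⟨g, hgc, hg0, hgC, hmap⟩ := exists_continuous_density_map_descend F j ρ' hρm hρc hρ0 hρC
  subst hμ'
  exact ⟨g, hgc, hgc.measurable, hg0, hgC, hmap, Node00.regSet_eq_univ_of_hasContVersion ⟨g, hgc, Filter.EventuallyEq.rfl⟩⟩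

end Step

/-! ## §2 The height-`K` law: the Gibbs density is continuous, positive and bounded -/

section Gibbs

/-- ★ **THE GIBBS LAW HAS A CONTINUOUS POSITIVE BOUNDED DENSITY** `boltzmann∕Z = e^{−βA}∕Z` (`β ≥ 0`). [cite: Balaban1985UV3, (4) p.257 (bookkeeping)] -/
theorem exists_continuous_density_gibbs (P : Params) {β : ℝ} (hβ : 0 ≤ β) :
    ∃ g : GaugeField P 0 ↥(Matrix.specialUnitaryGroup (Fin 2) ℂ) → ℝ, Continuous g ∧ Measurable g ∧ (∀ V, 0 ≤ g V) ∧ (∃ C : ℝ, ∀ V, g V ≤ C) ∧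
      T4GenFunBounds.gibbsMeasure P β = (fieldMeasure _ _ _).withDensity (fun V => ENNReal.ofReal (g V)) ∧
      Node00.regSet (fieldMeasure P 0 ↥(Matrix.specialUnitaryGroup (Fin 2) ℂ)) g = univ := by
  haveI : BorelSpace (GaugeField P 0 ↥(Matrix.specialUnitaryGroup (Fin 2) ℂ)) := T3OrbitAverage.instBorelSpaceGaugeField
  have hZ : 0 < partitionFn (G := ↥(Matrix.specialUnitaryGroup (Fin 2) ℂ)) P β := partitionFn_pos' P hβ
  have hgc : Continuous fun V : GaugeField P 0 ↥(Matrix.specialUnitaryGroup (Fin 2) ℂ) =>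
      boltzmann P β V / partitionFn (G := ↥(Matrix.specialUnitaryGroup (Fin 2) ℂ)) P β := by
    refine Continuous.div_const ?_ _
    unfold boltzmann
    exact Real.continuous_exp.comp (continuous_const.mul (continuous_wilsonAction4_SU 2 P 0))
  refine ⟨fun V => boltzmann P β V / partitionFn (G := ↥(Matrix.specialUnitaryGroup (Fin 2) ℂ)) P β, hgc, hgc.measurable,
    fun V => (boltzmann_div_partitionFn_pos P hβ V).le, ⟨1 / partitionFn (G := ↥(Matrix.specialUnitaryGroup (Fin 2) ℂ)) P β, fun V => ?_⟩,
    gibbsMeasure_eq_withDensity P hβ, Node00.regSet_eq_univ_of_hasContVersion ⟨_, hgc, Filter.EventuallyEq.rfl⟩⟩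
  exact div_le_div_of_nonneg_right (boltzmann_le_one P hβ V) hZ.le

end Gibbs

/-! ## §3 The runs: every law `ν K j`, `j ≤ K`, has a continuous bounded density (descending induction from `K`) -/

section Run

variable (F : T3Family) {γ : ℝ}

/-- ★★★ **EVERY LAW OF A RUN HAS AN EVERYWHERE-CONTINUOUS BOUNDED DENSITY.**  `γ ≥ 0`; `ν K K` the Gibbs law at `β_K = (γ·ε_K)⁻¹`, `ν K j = (descend F ℰp j)_* ν K (j+1)` for
`j < K`.  THEN for every `j ≤ K`: `ν K j = dU_j.withDensity (ofReal ∘ g)` with `g` continuous, measurable, `≥ 0`, bounded, `Node00.regSet dU_j g = univ` (§2 at `K`, §1 down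
the heights). [cite: Balaban1985UV3, (4)-(6) p.257 and p.263 (c); Balaban1987RG1, (0.13) p.254] -/
theorem exists_continuous_density_run (hγ : 0 ≤ γ)
    (ν : ℕ → (j : ℕ) → Measure (GaugeField (F.P j) 0 ↥(Matrix.specialUnitaryGroup (Fin 2) ℂ)))
    (hν1 : ∀ K, ν K K = T4GenFunBounds.gibbsMeasure (F.P K) ((F.scheme ℰp γ).β K))
    (hν2 : ∀ K j, j < K → ν K j = Measure.map (descend F ℰp j) (ν K (j + 1)))
    (K j : ℕ) (hjK : j ≤ K) :
    ∃ g : GaugeField (F.P j) 0 ↥(Matrix.specialUnitaryGroup (Fin 2) ℂ) → ℝ, Continuous g ∧ Measurable g ∧ (∀ V, 0 ≤ g V) ∧ (∃ C : ℝ, ∀ V, g V ≤ C) ∧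
      ν K j = (fieldMeasure _ _ _).withDensity (fun V => ENNReal.ofReal (g V)) ∧
      Node00.regSet (fieldMeasure (F.P j) 0 ↥(Matrix.specialUnitaryGroup (Fin 2) ℂ)) g = univ := by
  -- descending induction on the co-height `n = K - j`
  suffices h : ∀ n j, j + n = K → ∃ g : GaugeField (F.P j) 0 ↥(Matrix.specialUnitaryGroup (Fin 2) ℂ) → ℝ, Continuous g ∧ Measurable g ∧ (∀ V, 0 ≤ g V) ∧
      (∃ C : ℝ, ∀ V, g V ≤ C) ∧ ν K j = (fieldMeasure _ _ _).withDensity (fun V => ENNReal.ofReal (g V)) ∧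
      Node00.regSet (fieldMeasure (F.P j) 0 ↥(Matrix.specialUnitaryGroup (Fin 2) ℂ)) g = univ from h (K - j) j (by omega)
  intro n
  induction n with
  | zero =>
    intro j hj
    rw [add_zero] at hj
    subst hj
    rw [hν1 j]
    exact exists_continuous_density_gibbs (F.P j) (F.scheme_β_nonneg ℰp hγ j)
  | succ n ih =>
    intro j hj
    obtain ⟨g', hg'c, hg'm, hg'0, hg'C, hν', -⟩ := ih (j + 1) (by omega)
    obtain ⟨g, hgc, hgm, hg0, hgC, hmap, hreg⟩ := exists_continuous_density_anchorStep F j hg'm hg'c hg'0 hg'C hν'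
    exact ⟨g, hgc, hgm, hg0, hgC, (hν2 K j (by omega)).trans hmap, hreg⟩

/-- ★★★ **S1aᴴ (c) AT THE ANCHOR HEIGHTS, IN THE LINE'S LETTERS.**  Under the run hypotheses of `RunClassMembershipH` and `hanch : ∀ j, Ts ≤ j → μ j = ν K j`, EVERY anchor
height `Ts ≤ j ≤ K` carries a density `g` of `μ j` w.r.t. `dU_j` that is continuous on ALL of the configuration space (so `ContinuousOn g {PlaqSmall θ_j}` for every window),
measurable, `≥ 0`, bounded, with `Node00.regSet dU_j g = univ` (the one-version door's `hreg` for EVERY open window). [cite: Balaban1985UV3, p.263 (c); Balaban1987RG1, (0.13) p.254] -/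
theorem exists_continuous_density_anchor (hγ : 0 ≤ γ)
    (ν : ℕ → (j : ℕ) → Measure (GaugeField (F.P j) 0 ↥(Matrix.specialUnitaryGroup (Fin 2) ℂ)))
    (hν1 : ∀ K, ν K K = T4GenFunBounds.gibbsMeasure (F.P K) ((F.scheme ℰp γ).β K))
    (hν2 : ∀ K j, j < K → ν K j = Measure.map (descend F ℰp j) (ν K (j + 1)))
    {K Ts : ℕ} (μ : (j : ℕ) → Measure (GaugeField (F.P j) 0 ↥(Matrix.specialUnitaryGroup (Fin 2) ℂ)))
    (hanch : ∀ j, Ts ≤ j → μ j = ν K j) (j : ℕ) (hTj : Ts ≤ j) (hjK : j ≤ K) :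
    ∃ g : GaugeField (F.P j) 0 ↥(Matrix.specialUnitaryGroup (Fin 2) ℂ) → ℝ, Continuous g ∧ Measurable g ∧ (∀ V, 0 ≤ g V) ∧ (∃ C : ℝ, ∀ V, g V ≤ C) ∧
      μ j = (fieldMeasure _ _ _).withDensity (fun V => ENNReal.ofReal (g V)) ∧
      Node00.regSet (fieldMeasure (F.P j) 0 ↥(Matrix.specialUnitaryGroup (Fin 2) ℂ)) g = univ ∧
      ∀ S : Set (GaugeField (F.P j) 0 ↥(Matrix.specialUnitaryGroup (Fin 2) ℂ)), ContinuousOn g S := by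
  obtain ⟨g, hgc, hgm, hg0, hgC, hν, hreg⟩ := exists_continuous_density_run F hγ ν hν1 hν2 K j hjK
  exact ⟨g, hgc, hgm, hg0, hgC, (hanch j hTj).trans hν, hreg, fun S => hgc.continuousOn⟩

end Run

/-! ## §4 The whole tower: every height `j₀ ≤ j ≤ K` of a cut-and-anchored run has an everywhere-continuous density -/

section Tower

variable (F : T3Family) {γ b₀ p₀ : ℝ}

/-- ★★★ **THE (c)-DOOR FOR THE WHOLE TOWER.**  `0 < γ ≤ 1`, `0 < b₀`; a run `ν` (Gibbs at `K`, uncut steps down); a tower `μ` anchored at the heights `Ts ≤ j` (`μ j = ν K j`)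
and CUT below `Ts` by the line's smooth small-field cut-off at `θ_{j+1} = θBal_{j+1}` (written out as its defining product of clipped ramps, `Lines/runpair_organ.lean`'s `sfCut`
unfolds to it).  THEN there is a height `j₀ = j₀(F, γ, b₀, p₀)` such that EVERY `j₀ ≤ j ≤ K` carries a density `g` of `μ j` w.r.t. `dU_j` that is continuous EVERYWHERE, measurable
and `≥ 0`, with `Node00.regSet dU_j g = univ` — anchor heights by §3, cut heights by px17 g20's ✓`exists_continuous_density_cutStep_sfCut` (numerics ✓`exists_cutStep_numerics`),
descending induction from `Ts`.  This is the `hreg`∕`ρ₀` input of the one-version door ✓`…S1aTowerLawInvariance.exists_invariantVersion` at EVERY height and every open window.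
[cite: Balaban1985UV3, (4)-(6) p.257 and p.263 (c); Balaban1987RG1, (0.13) p.254] -/
theorem exists_continuous_density_tower (hγ : 0 < γ) (hγ1 : γ ≤ 1) (hb : 0 < b₀) (p₀ : ℝ)
    (ν : ℕ → (j : ℕ) → Measure (GaugeField (F.P j) 0 ↥(Matrix.specialUnitaryGroup (Fin 2) ℂ)))
    (hν1 : ∀ K, ν K K = T4GenFunBounds.gibbsMeasure (F.P K) ((F.scheme ℰp γ).β K))
    (hν2 : ∀ K j, j < K → ν K j = Measure.map (descend F ℰp j) (ν K (j + 1))) :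
    ∃ j₀ : ℕ, ∀ (K Ts : ℕ), Ts ≤ K → ∀ (μ : (j : ℕ) → Measure (GaugeField (F.P j) 0 ↥(Matrix.specialUnitaryGroup (Fin 2) ℂ))),
      (∀ j, Ts ≤ j → μ j = ν K j) →
      (∀ j, j < Ts → μ j = Measure.map (descend F ℰp j) ((μ (j + 1)).withDensity (fun U => ENNReal.ofReal
        (∏ p : Plaq (F.P (j + 1)) 0, max 0 (min 1 ((24 / 25 * θBal F.L γ b₀ p₀ (j + 1) - dist1 (GaugeField.plaqHol U p)) /
          ((24 / 25 - 1 / 2) * θBal F.L γ b₀ p₀ (j + 1)))))))) →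
      ∀ j, j₀ ≤ j → j ≤ K →
        ∃ g : GaugeField (F.P j) 0 ↥(Matrix.specialUnitaryGroup (Fin 2) ℂ) → ℝ, Continuous g ∧ Measurable g ∧ (∀ V, 0 ≤ g V) ∧
          μ j = (fieldMeasure _ _ _).withDensity (fun V => ENNReal.ofReal (g V)) ∧
          Node00.regSet (fieldMeasure (F.P j) 0 ↥(Matrix.specialUnitaryGroup (Fin 2) ℂ)) g = univ := by
  obtain ⟨α, hα24, hαδ, hαL, j₀, hnum⟩ := exists_cutStep_numerics F hγ hγ1 hb p₀
  refine ⟨j₀, fun K Ts hTs μ hanch hcut => ?_⟩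
  have hL1 : 1 ≤ F.L := F.hL.2.le
  -- anchor heights
  have hanchor : ∀ j, Ts ≤ j → j ≤ K → ∃ g : GaugeField (F.P j) 0 ↥(Matrix.specialUnitaryGroup (Fin 2) ℂ) → ℝ, Continuous g ∧ Measurable g ∧ (∀ V, 0 ≤ g V) ∧
      μ j = (fieldMeasure _ _ _).withDensity (fun V => ENNReal.ofReal (g V)) ∧
      Node00.regSet (fieldMeasure (F.P j) 0 ↥(Matrix.specialUnitaryGroup (Fin 2) ℂ)) g = univ := by
    intro j hTj hjK
    obtain ⟨g, hgc, hgm, hg0, -, hμ, hreg, -⟩ := exists_continuous_density_anchor F hγ.le ν hν1 hν2 μ hanch j hTj hjK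
    exact ⟨g, hgc, hgm, hg0, hμ, hreg⟩
  -- cut heights: descending induction from `Ts`
  have hcutInd : ∀ n j, j + n = Ts → j₀ ≤ j → ∃ g : GaugeField (F.P j) 0 ↥(Matrix.specialUnitaryGroup (Fin 2) ℂ) → ℝ, Continuous g ∧ Measurable g ∧ (∀ V, 0 ≤ g V) ∧
      μ j = (fieldMeasure _ _ _).withDensity (fun V => ENNReal.ofReal (g V)) ∧
      Node00.regSet (fieldMeasure (F.P j) 0 ↥(Matrix.specialUnitaryGroup (Fin 2) ℂ)) g = univ := by
    intro n
    induction n with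
    | zero =>
      intro j hj hj₀
      exact hanchor j (by omega) (by omega)
    | succ n ih =>
      intro j hj hj₀
      obtain ⟨g', hg'c, hg'm, hg'0, hμ', -⟩ := ih (j + 1) (by omega) (by omega)
      have hθ : 0 < θBal F.L γ b₀ p₀ (j + 1) := θBal_pos hL1 hγ hγ1 hb p₀ (j + 1)
      obtain ⟨g, hgc, hgm, hg0, hmap, hreg⟩ := exists_continuous_density_cutStep_sfCut F j hθ hα24 hαδ hαL (hnum j hj₀).2 hg'm
        hg'c.continuousOn (fun U _ => hg'0 U) hμ'
      exact ⟨g, hgc, hgm, hg0, (hcut j (by omega)).trans hmap, hreg⟩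
  intro j hj₀ hjK
  by_cases hTj : Ts ≤ j
  · exact hanchor j hTj hjK
  · exact hcutInd (Ts - j) j (by omega) hj₀

end Tower


end Summit.QuantumFields.YangMills.Theorems.FluctuationComparisonRegPrIntLS1aAnchorStepContinuousDensity

end
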